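import Summits.RiemannHypothesis.RiemannHypothesis.Theses.SpectralTrace
import Summits.RiemannHypothesis.RiemannHypothesis.Theorems.WindowStep.Negative.Collapse
import Summits.RiemannHypothesis.RiemannHypothesis.Theorems.SpectralTraceWindowCompactness
import Summits.RiemannHypothesis.RiemannHypothesis.Theorems.SpectralTraceWindowTraceToPositivity
import HarnessLib

/-!
# Calibration of the two RH-bearing stubs of line `christoffel-margin` (`stub_unitMargin`, `stub_positiveLadder`)

Route `RiemannHypothesis/SpectralTrace`, crux `WindowStep` (stmt-RiemannHypothesis-14659), line
`christoffel-margin` (lead seat a1). The line cuts the crux into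
`U := ∀ n ≥ 2, Trace(log n) → WeilPositivityOn (log(n+2)/2)` (the conclusion of `stub_unitMargin`)
and `PL := ∀ n ≥ 2, WindowTraceArch → WeilPositivityOn (log(n+1)/2) → Trace(log n)`
(`stub_positiveLadder`), where `Trace(A)` means: some real family `γ` reproduces the Weil functional
on the Weil tests supported in `[-A, A]`.

**What is proved (all unconditional, kernel-checked).**
* `marginPair_iff_windowTraceArch_imp_riemannHypothesis` : `(U ∧ PL) ↔ (WindowTraceArch → RH)` —
  the pair is EXACTLY as strong as the crux (`Negative/Collapse.lean`:
  `WindowStep ↔ (WindowTraceArch → RH)`); registered on the item as a lead helper.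
* `marginPair_failure_located` : if `WindowTraceArch ∧ ¬RH`, there is a rung `N ≥ 2` with
  `Trace(log N) ∧ ¬Trace(log(N+1))` at which `U(N)` fails or `PL(N+1)` fails — the honest content of
  the line ("where does the integer ladder die relative to the conjugate point") as a theorem.
* `unitMargin_two_iff`, `positiveLadder_three_iff` : the first contentful instances are
  `U(2) = (WindowTraceArch → WeilPositivityOn (log 2))` and
  `PL(3) = (WindowTraceArch → WeilPositivityOn (log 2) → WindowTracePrime2)`, i.e. `PL` at `n = 3`
  is the open sibling crux `WindowTracePrime2` from `Pos(log 2)` (beyond the tree's certified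
  `Pos(log 3 / 2)`): `stub_positiveLadder` is crux-sized.
* `unitMargin_of_riemannHypothesis`, `positiveLadder_of_riemannHypothesis` : both are RH-implied
  (so neither is refutable short of `¬RH`).
-/

set_option linter.dupNamespace false

noncomputable section

open Complex Set

namespace Summit.RiemannHypothesis.RiemannHypothesis.Theorems.SpectralTraceWindowStep

open Literature.NumberTheory.LFunctions
open Summit.RiemannHypothesis.RiemannHypothesis.Theses.SpectralTrace
open Summit.RiemannHypothesis.RiemannHypothesis.Theorems.WindowStep.Negative

/-- `Trace(A)` (file-local notation, as in `Negative/Collapse.lean`). -/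
local notation3 "WTrace " A:max => ∃ (ι : Type) (γ : ι → ℝ), ∀ g : ℝ → ℂ, IsWeilTest g →
  tsupport g ⊆ Set.Icc (-A) A →
    HasSum (fun i => weilMellin g (1 / 2 + (γ i : ℂ) * I)) (weilFunctional g)

/-! ## Both stubs are RH-implied -/

/-- Under RH every `WeilPositivityOn a` holds (Weil's criterion in Yoshida's form, unconditional in
the tree). [folklore] -/
theorem weilPositivityOn_of_riemannHypothesis' (hRH : _root_.RiemannHypothesis) (a : ℝ) :
    WeilPositivityOn a := by
  rcases le_or_gt a 0 with ha | ha
  · exact (windowTraceToPositivity_proof (2 * 1)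
      (windowTrace_of_riemannHypothesis hRH _)).mono (by linarith)
  · have h := windowTraceToPositivity_proof (2 * a) (windowTrace_of_riemannHypothesis hRH _)
    rwa [mul_div_cancel_left₀ a two_ne_zero] at h

/-- `U` is RH-implied. [folklore] -/
theorem unitMargin_of_riemannHypothesis (hRH : _root_.RiemannHypothesis) :
    ∀ n : ℕ, 2 ≤ n → (WTrace (Real.log (n : ℝ))) →
      WeilPositivityOn (Real.log ((n : ℝ) + 2) / 2) :=
  fun _ _ _ => weilPositivityOn_of_riemannHypothesis' hRH _

/-- `PL` is RH-implied. [folklore] -/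
theorem positiveLadder_of_riemannHypothesis (hRH : _root_.RiemannHypothesis) :
    ∀ n : ℕ, 2 ≤ n → WindowTraceArch → WeilPositivityOn (Real.log ((n : ℝ) + 1) / 2) →
      WTrace (Real.log (n : ℝ)) :=
  fun _ _ _ _ => windowTrace_of_riemannHypothesis hRH _

/-! ## The pair is exactly the crux -/

/-- `PL` as the card's `C′` (induction on the rung; positivity antitone): from `PL`, for every
`n ≥ 2`, `Trace(log n) → Pos(log(n+2)/2) → Trace(log(n+1))`. [folklore] -/
theorem marginRecrystallisation_of_positiveLadder'
    (hPL : ∀ n : ℕ, 2 ≤ n → WindowTraceArch → WeilPositivityOn (Real.log ((n : ℝ) + 1) / 2) →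
      WTrace (Real.log (n : ℝ))) :
    ∀ n : ℕ, 2 ≤ n → (WTrace (Real.log (n : ℝ))) →
      WeilPositivityOn (Real.log ((n : ℝ) + 2) / 2) → WTrace (Real.log ((n : ℝ) + 1)) := by
  intro n hn hT hpos
  have hArch : WindowTraceArch := seed_of_rung hn hT
  have h := hPL (n + 1) (by omega) hArch
  rw [Nat.cast_succ, add_assoc, one_add_one_eq_two] at h
  exact h hpos

/-- **`(U ∧ PL) ↔ (WindowTraceArch → RH)`** — the two RH-bearing stubs of line `christoffel-margin`
are JOINTLY exactly as strong as the crux `WindowStep` (`windowStep_iff_windowTraceArch_imp_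
riemannHypothesis`, Collapse): `→` composes them into the step (U: positivity one rung ahead; PL at
`n+1`: the next rung); `←` because each is RH-implied and the hypothesis of `U` contains the seed.
Registered on the crux item as a lead helper (signature spelled out verbatim). [folklore] -/
theorem marginPair_iff_windowTraceArch_imp_riemannHypothesis :
    ((∀ n : ℕ, 2 ≤ n →
        (∃ (ι : Type) (γ : ι → ℝ), ∀ g : ℝ → ℂ, Literature.NumberTheory.LFunctions.IsWeilTest g →
          tsupport g ⊆ Set.Icc (-Real.log (n : ℝ)) (Real.log (n : ℝ)) →
            HasSum (fun i => Literature.NumberTheory.LFunctions.weilMellin g (1 / 2 + (γ i : ℂ) * Complex.I))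
              (Literature.NumberTheory.LFunctions.weilFunctional g)) →
        Literature.NumberTheory.LFunctions.WeilPositivityOn (Real.log ((n : ℝ) + 2) / 2)) ∧
      (∀ n : ℕ, 2 ≤ n → Summit.RiemannHypothesis.RiemannHypothesis.Theses.SpectralTrace.WindowTraceArch →
        Literature.NumberTheory.LFunctions.WeilPositivityOn (Real.log ((n : ℝ) + 1) / 2) →
          ∃ (ι : Type) (γ : ι → ℝ), ∀ g : ℝ → ℂ, Literature.NumberTheory.LFunctions.IsWeilTest g →
            tsupport g ⊆ Set.Icc (-Real.log (n : ℝ)) (Real.log (n : ℝ)) →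
              HasSum (fun i => Literature.NumberTheory.LFunctions.weilMellin g (1 / 2 + (γ i : ℂ) * Complex.I))
                (Literature.NumberTheory.LFunctions.weilFunctional g))) ↔
    (Summit.RiemannHypothesis.RiemannHypothesis.Theses.SpectralTrace.WindowTraceArch →
      RiemannHypothesis) := by
  constructor
  · rintro ⟨hU, hPL⟩
    have hStep : WindowStep := fun n hn hT =>
      marginRecrystallisation_of_positiveLadder' hPL n hn hT (hU n hn hT)
    exact windowStep_iff_windowTraceArch_imp_riemannHypothesis.1 hStep
  · intro h
    refine ⟨fun n hn hT => ?_, fun n _ hArch _ => ?_⟩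
    · exact weilPositivityOn_of_riemannHypothesis' (h (seed_of_rung hn hT)) _
    · exact windowTrace_of_riemannHypothesis (h hArch) _

/-! ## Where the cut lies in a hypothetical `WindowTraceArch ∧ ¬RH` world -/

/-- **The failure is located at the last integer rung.** If the seed holds and RH fails, there is
`N ≥ 2` with `Trace(log N)` and `¬Trace(log(N+1))` (the integer ladder dies: `not_windowStep_iff`),
and at that rung `U(N)` fails or `PL(N+1)` fails: if `U(N)` gave `Pos(log(N+2)/2)`, then `PL(N+1)`
would give `Trace(log(N+1))`. So exactly one threshold comparison carries RH. [folklore] -/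
theorem marginPair_failure_located (hArch : WindowTraceArch) (hnRH : ¬ _root_.RiemannHypothesis) :
    ∃ N : ℕ, 2 ≤ N ∧ (WTrace (Real.log (N : ℝ))) ∧ ¬ (WTrace (Real.log ((N : ℝ) + 1))) ∧
      (¬ ((WTrace (Real.log (N : ℝ))) → WeilPositivityOn (Real.log ((N : ℝ) + 2) / 2)) ∨
        ¬ (WindowTraceArch → WeilPositivityOn (Real.log ((N : ℝ) + 2) / 2) →
            WTrace (Real.log ((N : ℝ) + 1)))) := by
  have hnot : ¬ WindowStep := not_windowStep_iff.2 ⟨hArch, hnRH⟩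
  simp only [WindowStep, not_forall] at hnot
  obtain ⟨N, hN, hT, hnT⟩ := hnot
  refine ⟨N, hN, hT, hnT, ?_⟩
  by_cases hU : (WTrace (Real.log (N : ℝ))) → WeilPositivityOn (Real.log ((N : ℝ) + 2) / 2)
  · right
    intro hPL
    exact hnT (hPL hArch (hU hT))
  · exact Or.inl hU

/-! ## First contentful instances -/

/-- `log 4 / 2 = log 2`. -/
theorem log_four_div_two : Real.log 4 / 2 = Real.log 2 := by
  rw [show (4 : ℝ) = 2 ^ 2 by norm_num, Real.log_pow]
  push_cast
  ring

/-- **`U(2)` is `WindowTraceArch → WeilPositivityOn (log 2)`** (positivity on `[-log 2, log 2]`,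
beyond the tree's certified `log 3 / 2`). [folklore] -/
theorem unitMargin_two_iff :
    ((WTrace (Real.log ((2 : ℕ) : ℝ))) → WeilPositivityOn (Real.log (((2 : ℕ) : ℝ) + 2) / 2)) ↔
      (WindowTraceArch → WeilPositivityOn (Real.log 2)) := by
  have e2 : ((2 : ℕ) : ℝ) = 2 := by norm_num
  rw [e2, show (2 : ℝ) + 2 = 4 by norm_num, log_four_div_two]
  rfl

/-- **`PL(3)` is `WindowTraceArch → WeilPositivityOn (log 2) → WindowTracePrime2`**: the first
contentful instance of `stub_positiveLadder` is the open sibling crux `Trace(log 3)` from the seed and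
positivity on `[-log 2, log 2]`. [folklore] -/
theorem positiveLadder_three_iff :
    (WindowTraceArch → WeilPositivityOn (Real.log (((3 : ℕ) : ℝ) + 1) / 2) →
        WTrace (Real.log ((3 : ℕ) : ℝ))) ↔
      (WindowTraceArch → WeilPositivityOn (Real.log 2) → WindowTracePrime2) := by
  have e3 : ((3 : ℕ) : ℝ) = 3 := by norm_num
  rw [e3, show (3 : ℝ) + 1 = 4 by norm_num, log_four_div_two]
  rfl

/-- **With the seed alone `U` buys exactly `Pos(log 2)`** and `PL` then buys `WindowTracePrime2`;
iterating is the whole ladder, i.e. RH (`marginPair_iff_…`). The first two moves, spelled out.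
[folklore] -/
theorem prime2_of_marginPair_of_windowTraceArch
    (hU : ∀ n : ℕ, 2 ≤ n → (WTrace (Real.log (n : ℝ))) →
      WeilPositivityOn (Real.log ((n : ℝ) + 2) / 2))
    (hPL : ∀ n : ℕ, 2 ≤ n → WindowTraceArch → WeilPositivityOn (Real.log ((n : ℝ) + 1) / 2) →
      WTrace (Real.log (n : ℝ)))
    (hArch : WindowTraceArch) : WeilPositivityOn (Real.log 2) ∧ WindowTracePrime2 := by
  have hU2 := unitMargin_two_iff.1 (hU 2 le_rfl) hArch
  exact ⟨hU2, positiveLadder_three_iff.1 (hPL 3 (by norm_num)) hArch hU2⟩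

end Summit.RiemannHypothesis.RiemannHypothesis.Theorems.SpectralTraceWindowStep

end
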